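import Summits.CriticalPhenomena.PercolationContinuityZ3.Theorems.PercNearOneGluingNoHeavyQuantLightSiblingStep
import Summits.CriticalPhenomena.PercolationContinuityZ3.Theorems.PercNearOneGluingNoHeavyQuantResidDEC
import HarnessLib

/-!
# QUANT lane R8, T-DEC: THE LIGHT NODE `LightResidDEC` — the top-level residual `resid a (wco a L) L` is DEC at the CAPPED floor
# `min (a·x) (1/2)` at every layer, for every outer gate `a ∈ (0,1)`; `ResidDEC ⟹ LightResidDEC ⟹ LightSiblingStep ⟹ Quant.FarTreeRow`,
# all unconditional (arm-1 gen 50, architect)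

builds on p205010 (kernel theorem, internal audit signed; external expert review pending)

Statement + support file (`--supports stmt-CriticalPhenomena-4575`), QUANT lane seat prim-quant-arm-1 (gen 50, architect), rung R8 of
`run/shared/lean/prim/quant/LADDER.md`; memo `run/shared/lean/prim/quant/prim-quant-arm-1-g50/ARCH-G50.md`.  Definitions `LightResidDECAt`
(one list, one gate), the schema `LightResidDECOn fam`, the node `@[conjecture] LightResidDEC := LightResidDECOn SibFam₃`; theorems with
standard axioms, no sorries.  Mirrors arm-1 g48's `…QuantRootScaledExpansionStep` (`decAt_flaw_of_sdec`, `decAt_gate_flaw_of_resid`,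
`sdec_flaw_of_resid`, `siblingStep_of_resid`) and typer g41's `…QuantResidDEC` (`ResidDECAt`, `ResidDECOn`, `ResidDEC`, `siblingStep_of_residDEC`,
`farTreeRow_of_residDEC`) with the invariant `SDEC` replaced by `SDECLight` (`…QuantSDECLight`) and the node `SiblingStep` by `LightSiblingStep`
(`…QuantLightSiblingStep`).

THE POINT (ARCH-G50 §1–§2).  The root-scaled expansion `gate (flaw L) a = w·flaw Lₐ + (1 − w)·resid a w L` reduces the node's obligation at outer
gate `a` to the residual; in the LIGHT induction the obligation is DEC at the CAPPED floor `z = min (a·x) (1/2)` only, and the product part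
`flaw Lₐ` is DEC at `z` for free from the LIGHT oracle (`decAt_flaw_of_sdecLight`: each `gate ρᵢ (a qᵢ)` is DEC at `min (a qᵢ x₁ᵢ) (1/2) ≥ z`,
then `convClosedT_holds`).  Hence:
* `def LightResidDECAt x a L := ∀ j < ftop L, DECAt (min (a·x) (1/2)) j (ftop L) (resid a (wco a L) L)`;
  `lightResidDECAt_of_residDECAt` (**`ResidDECAt ⟹ LightResidDECAt`**, floor-lowering); `decAt_siblings_of_lightResidDECAt`;
  `sdecLight_flaw_of_lightResidDECAt` (∀ `a < 1` ⟹ `SDECLight` of the forest, light-oracle-fed);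
* schema `LightResidDECOn fam`, `LightResidDECOn.mono`, `lightResidDECOn_of_residDECOn`; **`@[conjecture] LightResidDEC := LightResidDECOn SibFam₃`**,
  `lightResidDEC_iff`, **`lightResidDEC_of_residDEC : ResidDEC → LightResidDEC`**;
* **`lightSiblingStep_of_lightResidDEC`**, **`Quant.farTreeRow_of_lightResidDEC : LightResidDEC → FarTreeRow`** (unconditional).
So the node of record may be WEAKENED to its light part with the same unconditional consequence.  What the weakening buys (ARCH-G50 §2, exact
rationals): at the natural floor `a·x` the four closed-form certificate criteria of the lane (no-low ✓ p419148, half-top / low-ceiling ✓ p430395 /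
p425518, budget ✓ p423876) leave 1 419 exceptions on ≈ 40 000 (forest, a) pairs (heavy forests: identical glued `k ≤ 16`, 1 332 random heavy
forests with unequal gates `.9–.999` and mixed glued / chain / cherry / gapped sub-forests) — exactly census-1 g24's "partners needed / per-layer
only" region (RESID-DEC-G24 §7–§8); at the CAPPED floor they leave 0, with worst budget ratio `D/B = .59`.  The general proof target is therefore
ONE inequality at light floors `y ≤ 1/2`: the budget criterion `Σ_{low l ≥ 1} R_a(l)(T − l) ≤ Σ_{T < h ≤ H} R_a(h)(h − T)` (its degenerate cases
no-low / half-top / low-ceiling included).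

HONEST STATUS: `LightResidDEC`, `LightSiblingStep`, `ResidDEC`, `SiblingStep`, `FarTreeRow` OPEN (evidence-level: census-1 g24 0 / ≈ 3·10⁵ for
`ResidDEC`, a fortiori for the light node; closed-form criteria exception-free at the capped floor on ARCH-G50's zoo); this file is an
unconditional reduction.  RATE class log\* / honest sentence of `run/shared/lean/prim/quant/README.md` unchanged.  [this work]; expansion: arm-1 g48;
node of record: census-1 g24 / lead g47 / typer g41.  Nothing here is cited as a published result.  The gluing rows served
[cite: KozmaNitzan2024, Conjecture 3 (p. 15)]; product measure [cite: Grimmett1999, §1.3 p. 10].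
-/

noncomputable section

open scoped BigOperators

namespace Summit.CriticalPhenomena.PercolationContinuityZ3.Theorems
namespace Quant
namespace LawDec

open Finset

/-! ### Tools: floor-lowering of tree-OK data; the product part is free under the light oracle -/

/-- tree-OK sibling data at floor `x` is tree-OK at every lower floor `x′ ≤ x`. [this work] -/
theorem Sib.TreeOK.floor_le {x x' : ℝ} {s : Sib} (h : s.TreeOK x) (hxx : x' ≤ x) : s.TreeOK x' := by
  obtain ⟨hq0, hq1, hxq, hT, hnp⟩ := h
  exact ⟨hq0, hq1, hxx.trans hxq, hT, hnp⟩

/-- **THE PRODUCT PART IS FREE UNDER THE LIGHT ORACLE**: a forest of tree-built siblings at a LIGHT floor `0 < y ≤ 1/2` whose sub-forest laws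
are `SDECLight` at their floors is DEC at floor `y` at EVERY layer (`convClosedT_holds` along the list; top layers by Theorem A).  Each member
`gate ρᵢ qᵢ` is DEC at `min (qᵢ x₁ᵢ) (1/2) ≥ y`. [this work] -/
theorem decAt_flaw_of_sdecLight {y : ℝ} (hy0 : 0 < y) (hyh : y ≤ 1 / 2) :
    ∀ L : List Sib, (∀ s ∈ L, s.TreeOK y) → (∀ s ∈ L, SDECLight s.x₁ s.M s.ρ) → ∀ j, DECAt y j (ftop L) (flaw L)
  | [], _, _, j => by
    have hy1 : y < 1 := by linarith
    refine decAt_of_top_le 0 (flaw []) (fun h => ?_) (fun h hh => ?_) (by simp [flaw]) y hy1 (fun h hh => ?_) j (Nat.zero_le j)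
    · simp only [flaw]; split_ifs <;> norm_num
    · simp only [flaw]; rw [if_neg (by omega)]
    · simp only [flaw] at hh ⊢
      by_cases h0 : h = 0
      · subst h0; simp
      · rw [if_neg h0] at hh; exact absurd hh (lt_irrefl 0)
  | s :: L, hL, hS, j => by
    have hy1 : y < 1 := by linarith
    have hs := hL s List.mem_cons_self
    have hL' : ∀ t ∈ L, t.TreeOK y := fun t ht => hL t (List.mem_cons_of_mem s ht)
    have hS' : ∀ t ∈ L, SDECLight t.x₁ t.M t.ρ := fun t ht => hS t (List.mem_cons_of_mem s ht)
    obtain ⟨hq0, hq1, hxq, hT, _⟩ := hs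
    obtain ⟨_, hx₁1, ρ0, ρM, ρ1, ρta⟩ := hT.lawFacts
    -- the whole forest and the tail are tree-built at `y`
    have hW := (compForestN_of_list hy0 hy1 (s :: L) hL).treeBuiltN
    obtain ⟨_, _, w0, wM, w1, wta⟩ := hW.lawFacts
    have hF := (compForestN_of_list hy0 hy1 L hL').treeBuiltN
    obtain ⟨_, _, f0, fM, f1, fta⟩ := hF.lawFacts
    obtain ⟨g0, gM, g1⟩ := gate_laws s.M s.ρ s.q hq0.le hq1.le ρ0 ρM ρ1
    have ih : ∀ j', DECAt y j' (ftop L) (flaw L) := decAt_flaw_of_sdecLight hy0 hyh L hL' hS'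
    have htop : ftop (s :: L) = ftop L + s.M := rfl
    by_cases hj : j < ftop L + s.M
    · rw [htop]
      show DECAt y j (ftop L + s.M) (lconv (ftop L) s.M (flaw L) (gate s.ρ s.q))
      refine decAt_lconv_of_convClosedT convClosedT_holds y (ftop L) s.M (flaw L) (gate s.ρ s.q) hy0 hy1 f0 fM f1 g0 gM g1
        (fun h hh => ?_) (fun h hh => ?_) (fun j' _ => ih j') (fun j' hj' => ?_) j hj
      · have hhM : h ≤ ftop L := by
          by_contra hlt; exact absurd (fM h (not_le.1 hlt)) (ne_of_gt hh)
        have : y * (h : ℝ) ≤ y * (ftop L : ℝ) := mul_le_mul_of_nonneg_left (by exact_mod_cast hhM) hy0.le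
        linarith
      · have hhM : h ≤ s.M := by
          by_contra hlt; exact absurd (gM h (not_le.1 hlt)) (ne_of_gt hh)
        rw [sum_mul_gate]
        have e1 : y * (h : ℝ) ≤ y * (s.M : ℝ) := mul_le_mul_of_nonneg_left (by exact_mod_cast hhM) hy0.le
        have e2 : y * (s.M : ℝ) ≤ s.q * s.x₁ * (s.M : ℝ) := mul_le_mul_of_nonneg_right hxq (Nat.cast_nonneg _)
        have e3 : s.q * s.x₁ * (s.M : ℝ) ≤ s.q * ∑ k ∈ Finset.range (s.M + 1), (k : ℝ) * s.ρ k := by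
          rw [mul_assoc]; exact mul_le_mul_of_nonneg_left ρta hq0.le
        linarith
      · have d := hS s List.mem_cons_self s.q hq0 hq1.le j' hj'
        exact decAt_mono_floor (le_min hxq hyh) (lt_of_le_of_lt (min_le_right _ _) (by norm_num)) d
    · rw [htop]
      exact decAt_of_top_le (ftop L + s.M) (flaw (s :: L)) w0 wM w1 y hy1 (fun h hh => by
        have hhM : h ≤ ftop L + s.M := by
          by_contra hlt; exact absurd (wM h (not_le.1 hlt)) (ne_of_gt hh)
        have : y * (h : ℝ) ≤ y * ((ftop L + s.M : ℕ) : ℝ) := mul_le_mul_of_nonneg_left (by exact_mod_cast hhM) hy0.le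
        rw [htop] at wta
        linarith) j (not_lt.1 hj)

/-- the LIGHT oracle of the light sibling step supplies `SDECLight` of every member's sub-forest law. [this work] -/
theorem sdecLight_members_of_oracle {x : ℝ} (L : List Sib) (hL : ∀ s ∈ L, s.TreeOK x)
    (hO : ∀ (x' : ℝ) (n' M' : ℕ) (μ' : ℕ → ℝ), n' < fgates L → TreeBuiltN x' n' M' μ' → SDECLight x' M' μ') :
    ∀ s ∈ L, SDECLight s.x₁ s.M s.ρ :=
  fun s hs => hO s.x₁ s.n s.M s.ρ (lt_fgates_of_mem L s hs) (hL s hs).2.2.2.1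

/-- **THE LIGHT OBLIGATION AT OUTER GATE `a` FROM THE RESIDUAL ALONE.**  Tree-built siblings at floor `0 < x < 1` with `SDECLight` sub-forest laws,
an outer gate `0 < a ≤ 1`, a weight `0 ≤ w ≤ wco a L`, `w < 1`: if `resid a w L` is DEC at the CAPPED floor `min (a·x) (1/2)` at every layer below
the top, then so is `gate (flaw L) a` — the product part `flaw Lₐ` being DEC there for free (`decAt_flaw_of_sdecLight` on the scaled list at the
capped floor) and the two mixed at the common target `a·fmean L`. [this work] -/
theorem decAt_gate_flaw_of_resid_light {x a w : ℝ} (hx0 : 0 < x) (ha0 : 0 < a) (ha1 : a ≤ 1)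
    (L : List Sib) (hL : ∀ s ∈ L, s.TreeOK x) (hρ : ∀ s ∈ L, SDECLight s.x₁ s.M s.ρ)
    (hw0 : 0 ≤ w) (hw : w ≤ wco a L) (hw1 : w < 1)
    (hR : ∀ j, j < ftop L → DECAt (min (a * x) (1 / 2)) j (ftop L) (resid a w L))
    (j : ℕ) (hj : j < ftop L) : DECAt (min (a * x) (1 / 2)) j (ftop L) (gate (flaw L) a) := by
  have hL' : ∀ s ∈ L, s.LawOK := fun s hs => (hL s hs).lawOK
  set z : ℝ := min (a * x) (1 / 2) with hzdef
  have hz0 : 0 < z := lt_min (mul_pos ha0 hx0) (by norm_num)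
  have hzh : z ≤ 1 / 2 := min_le_right _ _
  have hzax : z ≤ a * x := min_le_left _ _
  obtain ⟨f0, fM, f1, fmn⟩ := flaw_facts L hL'
  obtain ⟨_, _, _, famn⟩ := flaw_facts (L.map (Sib.scale a)) (map_scale_lawOK ha0 ha1 L hL')
  rw [ftop_map_scale, fmean_map_scale] at famn
  obtain ⟨_, _, _, rmn⟩ := resid_laws ha0 ha1 L hL' hw hw1
  -- (P): the scaled forest at the capped floor, free
  have hP : DECAtT z (a * fmean L) j (ftop L) (flaw (L.map (Sib.scale a))) := by
    have hTz : ∀ s ∈ L.map (Sib.scale a), s.TreeOK z := fun s hs => (map_scale_treeOK ha0 ha1 L hL s hs).floor_le hzax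
    have d := decAt_flaw_of_sdecLight hz0 hzh (L.map (Sib.scale a)) hTz
      (fun s hs => by
        obtain ⟨t, ht, rfl⟩ := List.mem_map.1 hs
        exact hρ t ht) j
    rw [ftop_map_scale, decAt_iff_decAtT, famn] at d
    exact d
  -- (R): the residual, by hypothesis
  have hRT : DECAtT z (a * fmean L) j (ftop L) (resid a w L) := by
    have d := hR j hj
    rw [decAt_iff_decAtT, rmn] at d
    exact d
  have mix := decAtT_mixture w hw0 hw1.le hP hRT
  have e : gate (flaw L) a = fun h => w * flaw (L.map (Sib.scale a)) h + (1 - w) * resid a w L h :=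
    funext fun h => gate_flaw_eq_mix a w L hw1 h
  rw [decAt_iff_decAtT, sum_mul_gate, fmn, e]
  exact mix

/-- **`SDECLight` OF THE FOREST FROM THE TWO PER-GATE CLAIMS, LIGHT FORM** (README V428 (3) at the capped floor): (I) for `0 < a ≤ a₁` the gated
forest is DEC at `min (a x) (1/2)` at every layer below the top; (II) for `a₁ < a < 1` the residual `resid a (w a) L` is, with admissible weights;
`a = 1` is the free product part. [this work] -/
theorem sdecLight_flaw_of_resid {x : ℝ} (hx0 : 0 < x) (L : List Sib) (hL : ∀ s ∈ L, s.TreeOK x)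
    (hρ : ∀ s ∈ L, SDECLight s.x₁ s.M s.ρ) (a₁ : ℝ) (w : ℝ → ℝ)
    (hI : ∀ a, 0 < a → a ≤ a₁ → a < 1 → ∀ j, j < ftop L → DECAt (min (a * x) (1 / 2)) j (ftop L) (gate (flaw L) a))
    (hw : ∀ a, a₁ < a → a < 1 → 0 ≤ w a ∧ w a ≤ wco a L ∧ w a < 1)
    (hII : ∀ a, a₁ < a → a < 1 → ∀ j, j < ftop L → DECAt (min (a * x) (1 / 2)) j (ftop L) (resid a (w a) L)) :
    SDECLight x (ftop L) (flaw L) := by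
  intro a ha0 ha1 j hj
  rcases eq_or_lt_of_le ha1 with rfl | hlt
  · rw [gate_one, one_mul]
    have hz0 : 0 < min x (1 / 2) := lt_min hx0 (by norm_num)
    exact decAt_flaw_of_sdecLight hz0 (min_le_right _ _) L (fun s hs => (hL s hs).floor_le (min_le_left _ _)) hρ j
  · by_cases hle : a ≤ a₁
    · exact hI a ha0 hle hlt j hj
    · obtain ⟨hw0, hwle, hw1⟩ := hw a (not_le.1 hle) hlt
      exact decAt_gate_flaw_of_resid_light hx0 ha0 ha1 L hL hρ hw0 hwle hw1 (hII a (not_le.1 hle) hlt) j hj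

/-! ### The light node for one list at one outer gate -/

/-- **LIGHT RESID-DEC for the list `L` at floor `x` and outer gate `a`**: the residual at the canonical weight, `resid a (wco a L) L`, is DEC at
the CAPPED floor `min (a·x) (1/2)` at every layer below the top `ftop L`. [this work] -/
def LightResidDECAt (x a : ℝ) (L : List Sib) : Prop :=
  ∀ j, j < ftop L → DECAt (min (a * x) (1 / 2)) j (ftop L) (resid a (wco a L) L)

/-- **`ResidDECAt ⟹ LightResidDECAt`** (floor-lowering `min (a x) (1/2) ≤ a x < 1`; `0 < a < 1`, `x < 1`). [this work] -/
theorem lightResidDECAt_of_residDECAt {x a : ℝ} (hx1 : x < 1) (ha0 : 0 < a) (ha1 : a ≤ 1) {L : List Sib} (h : ResidDECAt x a L) :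
    LightResidDECAt x a L :=
  fun j hj => decAt_mono_floor (min_le_left _ _) (by nlinarith) (h j hj)

/-- for light gated floors `a·x ≤ 1/2` the two coincide. [this work] -/
theorem lightResidDECAt_iff_of_le_half {x a : ℝ} (hax : a * x ≤ 1 / 2) (L : List Sib) : LightResidDECAt x a L ↔ ResidDECAt x a L := by
  unfold LightResidDECAt ResidDECAt
  rw [min_eq_left hax]

/-- **LIGHT RESID-DEC at gate `a` gives the light obligation at gate `a`** (tree-OK siblings, light-oracle-fed `SDECLight` of the sub-forest laws,
`≥ 2` siblings; canonical weight). [this work] -/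
theorem decAt_siblings_of_lightResidDECAt {x a : ℝ} (hx0 : 0 < x) (ha0 : 0 < a) (ha1 : a < 1) (L : List Sib)
    (hL : ∀ s ∈ L, s.TreeOK x) (hρ : ∀ s ∈ L, SDECLight s.x₁ s.M s.ρ) (hk : 2 ≤ L.length) (h : LightResidDECAt x a L) :
    ∀ j, j < ftop L → DECAt (min (a * x) (1 / 2)) j (ftop L) (gate (flaw L) a) := by
  obtain ⟨hw0, hw, hw1⟩ := wco_admissible ha1 L hL hk
  exact fun j hj => decAt_gate_flaw_of_resid_light hx0 ha0 ha1.le L hL hρ hw0 hw hw1 h j hj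

/-- **LIGHT RESID-DEC AT EVERY OUTER GATE `a < 1` CERTIFIES `SDECLight` OF THE FOREST** (threshold `a₁ = 0`, claim (I) vacuous). [this work] -/
theorem sdecLight_flaw_of_lightResidDECAt {x : ℝ} (hx0 : 0 < x) (L : List Sib) (hL : ∀ s ∈ L, s.TreeOK x)
    (hρ : ∀ s ∈ L, SDECLight s.x₁ s.M s.ρ) (hk : 2 ≤ L.length) (h : ∀ a : ℝ, 0 < a → a < 1 → LightResidDECAt x a L) :
    SDECLight x (ftop L) (flaw L) :=
  sdecLight_flaw_of_resid hx0 L hL hρ 0 (fun a => wco a L) (fun _ ha0 hle _ _ _ => absurd hle (not_le.2 ha0))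
    (fun _ _ ha1 => wco_admissible ha1 L hL hk) (fun a ha0 ha1 => h a ha0 ha1)

/-! ### The light node -/

/-- **LIGHT RESID-DEC ON A FAMILY OF SIBLING LISTS** (schema; a refuted variant lands as `¬ LightResidDECOn fam`). [this work] -/
def LightResidDECOn (fam : ℝ → List Sib → Prop) : Prop :=
  ∀ (x : ℝ) (L : List Sib), 0 < x → x < 1 → fam x L → ∀ a : ℝ, 0 < a → a < 1 → LightResidDECAt x a L

/-- the schema is antitone in the family. [this work] -/
theorem LightResidDECOn.mono {fam fam' : ℝ → List Sib → Prop} (h : LightResidDECOn fam) (hff : ∀ x L, fam' x L → fam x L) :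
    LightResidDECOn fam' :=
  fun x L hx0 hx1 hf => h x L hx0 hx1 (hff x L hf)

/-- `ResidDECOn fam ⟹ LightResidDECOn fam`. [this work] -/
theorem lightResidDECOn_of_residDECOn {fam : ℝ → List Sib → Prop} (h : ResidDECOn fam) : LightResidDECOn fam :=
  fun x L hx0 hx1 hf a ha0 ha1 => lightResidDECAt_of_residDECAt hx1 ha0 ha1.le (h x L hx0 hx1 hf a ha0 ha1)

/-- **CONJECTURE `LIGHT RESID-DEC` — THE LIGHT PART OF THE NODE OF RECORD (arm-1 g50 ARCH-G50).**  For every forest of `k ≥ 3` tree-built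
composite siblings at floor `0 < x < 1` (`SibFam₃`) and every outer gate `0 < a < 1`, the top-level residual at the canonical weight,
`resid a (wco a L) L` (nonnegative law of mean `a·fmean L`), is DEC at the CAPPED floor `min (a·x) (1/2)` at every layer `j < ftop L`.
KERNEL FACTS: `ResidDEC ⟹ LightResidDEC` (`lightResidDEC_of_residDEC`); `LightResidDEC ⟹ LightSiblingStep ⟹ Quant.FarTreeRow` unconditionally
(`lightSiblingStep_of_lightResidDEC`, `farTreeRow_of_lightResidDEC`).  It differs from `ResidDEC` exactly on heavy gated floors `a·x > 1/2`, where
the obligation is lowered to floor `1/2`.  EVIDENCE: every certificate of `ResidDEC` (census-1 g24, 0 / ≈ 3·10⁵ exact) is one; at the capped floor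
the four closed-form criteria (no-low, half-top, low-ceiling, budget) certify 100 % of ARCH-G50's ≈ 40 000 exact (forest, a) pairs incl. 1 332
heavy random forests with unequal gates, against 1 419 exceptions at the natural floor.  OPEN: a k-general proof — the target is the budget
inequality at floors `≤ 1/2`.  builds on p205010 (kernel theorem, internal audit signed; external expert review pending).
[this work] [status: open] -/
@[conjecture] def LightResidDEC : Prop :=
  LightResidDECOn SibFam₃

/-- `LightResidDEC` unfolded. [this work] -/
theorem lightResidDEC_iff :
    LightResidDEC ↔ ∀ (x : ℝ) (L : List Sib), 0 < x → x < 1 → (∀ s ∈ L, s.TreeOK x) → 3 ≤ L.length →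
      ∀ a : ℝ, 0 < a → a < 1 → ∀ j, j < ftop L → DECAt (min (a * x) (1 / 2)) j (ftop L) (resid a (wco a L) L) :=
  ⟨fun h x L hx0 hx1 hL hk a ha0 ha1 => h x L hx0 hx1 ⟨hL, hk⟩ a ha0 ha1,
    fun h x L hx0 hx1 hf a ha0 ha1 => h x L hx0 hx1 hf.1 hf.2 a ha0 ha1⟩

/-- **`ResidDEC ⟹ LightResidDEC`**: the light node is implied by the node of record. [this work] -/
theorem lightResidDEC_of_residDEC (h : ResidDEC) : LightResidDEC :=
  lightResidDECOn_of_residDECOn h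

/-- **`LightResidDEC ⟹ LightSiblingStep`** (list bridge `exists_list_of_compForestN`; the product part free under the LIGHT oracle;
`sdecLight_flaw_of_lightResidDECAt`). [this work] -/
theorem lightSiblingStep_of_lightResidDEC (h : LightResidDEC) : LightSiblingStep := by
  intro x n M k μ hk hF hO
  obtain ⟨L, hL, hn, hM, hμ, hkL⟩ := exists_list_of_compForestN hF
  subst hn hM hμ hkL
  have hx0 : 0 < x := hF.floor.1
  have hx1 : x < 1 := hF.floor.2
  exact sdecLight_flaw_of_lightResidDECAt hx0 L hL (sdecLight_members_of_oracle L hL hO) (by omega)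
    (h x L hx0 hx1 ⟨hL, hk⟩)

end LawDec

/-- **`LightResidDEC ⟹ Quant.FarTreeRow`, UNCONDITIONALLY.**  (The node of record factors through it: `farTreeRow_of_residDEC` =
`farTreeRow_of_lightResidDEC ∘ lightResidDEC_of_residDEC` up to proof irrelevance.) [this work] -/
theorem farTreeRow_of_lightResidDEC (h : LawDec.LightResidDEC) : FarTreeRow :=
  farTreeRow_of_lightSiblingStep (LawDec.lightSiblingStep_of_lightResidDEC h)

end Quant
end Summit.CriticalPhenomena.PercolationContinuityZ3.Theorems
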